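import Mathlib
import Summits.Ventures.PercRepro2.CoinChainTowerMarker
import Summits.Ventures.PercRepro2.CoinChainMarkerACoins

/-!
# The marker at the bottom vertex of an OR-tower — ARBITRARY coins on its entries
(blind cell PercRepro2, night-2 g18; proofs/NIGHT2-DARC.md §58.8)

`darc_of_towerMarkerV₁` (§57.13) takes the bottom vertex `v₁` of a pendant OR-tower with SURE
entry coins.  Here the sure-coin hypothesis is removed by the subdivision of §52: the entry arcs
of `v₁` are subdivided by sure arcs (`orTailK_sub`), the tower above `v₁` and the free-arc vertex
`a` survive the subdivision untouched (`OrTower.sub_untouched`, `orTailK_sub_untouched'`), the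
tower core of the transported list is the subdivided tower core (`towerCore_map_sub`), and
`darc_sub_iff` transports the row back: **`darc_of_towerMarkerV₁_coins`** — the first marker at
the bottom vertex of a pendant OR-tower of any height over any log-supermodular core, ANY coins
on its entries, ANY coins above, the second marker covering the rest; `_swap` and the out-tree
corollary.  `darc_of_chainMarkerA'_coins` (§57.8) is the case `rest = []`.
-/

namespace Summit.Ventures.PercRepro2.Coin

open Classical

section TowerSub

variable {V : Type*} {E : Type*} [Fintype V] [DecidableEq V] [Fintype E] [DecidableEq E]
  {R : Type*} [Field R] [LinearOrder R] [IsStrictOrderedRing R]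
  {arcs : E → Finset (V × V)} {s : V} {S : Finset E} {src tgt : E → V}

omit [Fintype V] [Fintype E] [Field R] [LinearOrder R] [IsStrictOrderedRing R] in
/-- The tower core of the transported tower list is the subdivided tower core. -/
lemma towerCore_map_sub (S : Finset E) :
    ∀ (L : List (Finset V × (V → E) × V)) (U₀ : Finset V),
      towerCore (subCore U₀ S) (L.map fun x => (x.1.map Function.Embedding.inl,
          Sum.elim (fun v => Sum.inl (x.2.1 v)) (fun e => Sum.inr e), Sum.inl x.2.2)) =
        subCore (towerCore U₀ L) S
  | [], _ => rfl
  | x :: rest, U₀ => by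
      simp only [List.map_cons, towerCore]
      rw [← subCore_insert_left]
      exact towerCore_map_sub S rest (insert x.2.2 U₀)

omit [Fintype V] [Fintype E] [Field R] [LinearOrder R] [IsStrictOrderedRing R] in
/-- An OR-tower none of whose coins is subdivided survives the subdivision of other arcs
(the subdivided arcs start in the base core and end outside the tower vertices). -/
lemma OrTower.sub_untouched {U₀ : Finset V} {L : List (Finset V × (V → E) × V)}
    (hT : OrTower arcs s U₀ L) (hS : ∀ e ∈ S, arcs e = {(src e, tgt e)})
    (htgts : ∀ e ∈ S, tgt e ≠ s) :
    (∀ e ∈ S, src e ∈ U₀) → (∀ e ∈ S, ∀ x ∈ L, tgt e ≠ x.2.2) →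
    OrTower (subArcs arcs S src tgt) (Sum.inl s) (subCore U₀ S)
      (L.map fun x => (x.1.map Function.Embedding.inl,
        Sum.elim (fun v => Sum.inl (x.2.1 v)) (fun e => Sum.inr e), Sum.inl x.2.2)) := by
  induction hT with
  | nil U => intro _ _; exact OrTower.nil _
  | cons U ent c v rest h₀ _ ih =>
    intro hsrc htgt
    simp only [List.map_cons]
    have htgtv : ∀ e ∈ S, tgt e ≠ v := fun e he => htgt e he (ent, c, v) (List.mem_cons_self)
    have hc₀ : ∀ r ∈ ent, c r ∉ S := by
      intro r hr hmem
      have h1 := h₀.arcs_c r hr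
      have h2 := hS (c r) hmem
      rw [h1] at h2
      have : (r, v) ∈ ({(src (c r), tgt (c r))} : Finset (V × V)) := by
        rw [← h2]; exact Finset.mem_singleton_self _
      rw [Finset.mem_singleton, Prod.mk.injEq] at this
      exact htgtv (c r) hmem this.2.symm
    have h₀' := orTailK_sub_untouched' (S := S) (src := src) (tgt := tgt) h₀ hsrc htgts htgtv hc₀
    have ih' := ih (fun e he => Finset.mem_insert_of_mem (hsrc e he))
      (fun e he x hx => htgt e he x (List.mem_cons_of_mem _ hx))
    rw [subCore_insert_left] at ih'
    exact OrTower.cons _ _ _ _ _ h₀' ih'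

end TowerSub

section TowerMarkerCoins

variable {V : Type*} {E : Type*} [Fintype V] [DecidableEq V] [Fintype E] [DecidableEq E]
  {R : Type*} [Field R] [LinearOrder R] [IsStrictOrderedRing R]
  {arcs : E → Finset (V × V)} {s : V} {U : Finset V} {ent ent₁ : Finset V} {c c₁ : V → E}
  {a v₁ w : V} {rest : List (Finset V × (V → E) × V)}

/-- **THEOREM (the first marker at the BOTTOM vertex of an OR-tower, ARBITRARY coins).**
`OrTailK arcs s U ent₁ c₁ v₁` with ANY entry set and ANY coins, `OrTower arcs s (insert v₁ U) rest`
with every entry of every level equal to `m₂` or outside `U` (any coins), `a` an OR-vertex of the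
tower core with every entry equal to `m₂` or outside `U` (any coins), the cluster law of `U`
log-supermodular, `m₂ ∈ U`, `t, w ∉ insert a (towerCore (insert v₁ U) rest)`, `t, w ≠ s` ⟹
`DARC pr arcs s {t} v₁ m₂ a w` — `darc_of_towerMarkerV₁` after the subdivision of the entry
coins of `v₁`. -/
theorem darc_of_towerMarkerV₁_coins (pr : E → R) (hp : IsProbVec pr) (hS : SameEnds arcs)
    (h₁ : OrTailK arcs s U ent₁ c₁ v₁) (hT : OrTower arcs s (insert v₁ U) rest)
    (h : OrTailK arcs s (towerCore (insert v₁ U) rest) ent c a)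
    {m₂ : V} (hm₂ : m₂ ∈ U) (hcovL : ∀ x ∈ rest, ∀ r ∈ x.1, r = m₂ ∨ r ∉ U)
    (hcov : ∀ r ∈ ent, r = m₂ ∨ r ∉ U)
    (hν : ∀ W W', W ⊆ U → W' ⊆ U →
      prob pr (coreLevel arcs s U W) * prob pr (coreLevel arcs s U W') ≤
        prob pr (coreLevel arcs s U (W ∩ W')) * prob pr (coreLevel arcs s U (W ∪ W')))
    {t : V} (htC : t ∉ insert a (towerCore (insert v₁ U) rest)) (hts : t ≠ s) (hws : w ≠ s)
    (hwC : w ∉ insert a (towerCore (insert v₁ U) rest)) :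
    DARC pr arcs s {t} v₁ m₂ a w := by
  have hUC : insert v₁ U ⊆ towerCore (insert v₁ U) rest := subset_towerCore _ rest
  have haC' : a ∉ towerCore (insert v₁ U) rest := h.a_notin
  have hv₁a : v₁ ≠ a := fun e => haC' (e ▸ hUC (Finset.mem_insert_self v₁ U))
  have hvert := hT.vertex_notin
  have hv₁v : ∀ x ∈ rest, v₁ ≠ x.2.2 := fun x hx e => hvert x hx (e ▸ Finset.mem_insert_self v₁ U)
  -- the subdivided coins: the entry coins of `v₁`
  have hSa := h₁.arcs_entry
  have hsrc : ∀ e ∈ ent₁.image c₁, srcOf ent₁ c₁ s e ∈ insert v₁ U :=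
    fun e he => Finset.mem_insert_of_mem (h₁.ent_sub (h₁.srcOf_mem he))
  have hsrc' : ∀ e ∈ ent₁.image c₁, srcOf ent₁ c₁ s e ∈ towerCore (insert v₁ U) rest :=
    fun e he => hUC (hsrc e he)
  have htgts : ∀ e ∈ ent₁.image c₁, (fun _ => v₁) e ≠ s := fun _ _ => h₁.a_ne_s
  have htgtL : ∀ e ∈ ent₁.image c₁, ∀ x ∈ rest, (fun _ => v₁) e ≠ x.2.2 :=
    fun _ _ x hx => hv₁v x hx
  have htgta : ∀ e ∈ ent₁.image c₁, (fun _ => v₁) e ≠ a := fun _ _ => hv₁a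
  have hc₀ : ∀ r ∈ ent, c r ∉ ent₁.image c₁ := by
    intro r hr hmem
    obtain ⟨q, hq, hqr⟩ := Finset.mem_image.1 hmem
    have h1 := h.arcs_c r hr
    have h2 := h₁.arcs_c q hq
    rw [hqr] at h2
    rw [h1] at h2
    have : (r, a) ∈ ({(q, v₁)} : Finset (V × V)) := by rw [← h2]; exact Finset.mem_singleton_self _
    rw [Finset.mem_singleton, Prod.mk.injEq] at this
    exact hv₁a this.2.symm
  -- the three structures of the subdivided system
  have h₁_sub := orTailK_sub h₁
  have hT_sub := hT.sub_untouched (S := ent₁.image c₁) (src := srcOf ent₁ c₁ s)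
    (tgt := fun _ => v₁) hSa htgts hsrc htgtL
  rw [subCore_insert_left] at hT_sub
  have h_sub := orTailK_sub_untouched' (S := ent₁.image c₁) (src := srcOf ent₁ c₁ s)
    (tgt := fun _ => v₁) h hsrc' htgts htgta hc₀
  rw [← towerCore_map_sub (ent₁.image c₁) rest (insert v₁ U), subCore_insert_left] at h_sub
  -- the data of the subdivided core
  have htC₁ : t ∉ insert v₁ U := fun hx => htC (Finset.mem_insert_of_mem (hUC hx))
  have hwC₁ : w ∉ insert v₁ U := fun hx => hwC (Finset.mem_insert_of_mem (hUC hx))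
  obtain ⟨hsure', hν', _, _⟩ := h₁.sub_data (w := w) pr hp hν htC₁ hwC₁
  have hm₂' : Sum.inl m₂ ∈ subCore U (ent₁.image c₁) := (inl_mem_subCore).2 hm₂
  have hcovL' : ∀ x ∈ rest.map (fun x => (x.1.map (Function.Embedding.inl : V ↪ V ⊕ E),
        Sum.elim (fun v => (Sum.inl (x.2.1 v) : E ⊕ E)) (fun e => (Sum.inr e : E ⊕ E)),
        (Sum.inl x.2.2 : V ⊕ E))),
      ∀ r ∈ x.1, r = (Sum.inl m₂ : V ⊕ E) ∨ r ∉ subCore U (ent₁.image c₁) := by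
    intro x hx r hr
    obtain ⟨x₀, hx₀, rfl⟩ := List.mem_map.1 hx
    obtain ⟨r₀, hr₀, rfl⟩ := Finset.mem_map.1 hr
    rcases hcovL x₀ hx₀ r₀ hr₀ with rfl | hr₀U
    · exact Or.inl rfl
    · exact Or.inr fun hmem => hr₀U ((inl_mem_subCore).1 hmem)
  have hcov' : ∀ r ∈ ent.map (Function.Embedding.inl : V ↪ V ⊕ E),
      r = (Sum.inl m₂ : V ⊕ E) ∨ r ∉ subCore U (ent₁.image c₁) := by
    intro r hr
    obtain ⟨r₀, hr₀, rfl⟩ := Finset.mem_map.1 hr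
    rcases hcov r₀ hr₀ with rfl | hr₀U
    · exact Or.inl rfl
    · exact Or.inr fun hmem => hr₀U ((inl_mem_subCore).1 hmem)
  have htC' : Sum.inl t ∉ insert (Sum.inl a) (towerCore (insert (Sum.inl v₁)
      (subCore U (ent₁.image c₁))) (rest.map (fun x => (x.1.map (Function.Embedding.inl : V ↪ V ⊕ E),
        Sum.elim (fun v => (Sum.inl (x.2.1 v) : E ⊕ E)) (fun e => (Sum.inr e : E ⊕ E)),
        (Sum.inl x.2.2 : V ⊕ E))))) := by
    rw [← subCore_insert_left, towerCore_map_sub, Finset.mem_insert, inl_mem_subCore, not_or]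
    rw [Finset.mem_insert, not_or] at htC
    exact ⟨fun e => htC.1 (Sum.inl_injective e), htC.2⟩
  have hwC' : Sum.inl w ∉ insert (Sum.inl a) (towerCore (insert (Sum.inl v₁)
      (subCore U (ent₁.image c₁))) (rest.map (fun x => (x.1.map (Function.Embedding.inl : V ↪ V ⊕ E),
        Sum.elim (fun v => (Sum.inl (x.2.1 v) : E ⊕ E)) (fun e => (Sum.inr e : E ⊕ E)),
        (Sum.inl x.2.2 : V ⊕ E))))) := by
    rw [← subCore_insert_left, towerCore_map_sub, Finset.mem_insert, inl_mem_subCore, not_or]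
    rw [Finset.mem_insert, not_or] at hwC
    exact ⟨fun e => hwC.1 (Sum.inl_injective e), hwC.2⟩
  have key := darc_of_towerMarkerV₁ (subPr pr) (isProbVec_subPr hp) (sameEnds_sub hS) h₁_sub
    hT_sub h_sub hsure' hm₂' hcovL' hcov' hν' htC' (fun e => hts (Sum.inl_injective e))
    (fun e => hws (Sum.inl_injective e)) hwC'
  have hiff := darc_sub_iff hSa pr s {t} v₁ m₂ a w
  rw [Finset.map_singleton] at hiff
  exact hiff.1 key

/-- **The mirror: markers `(m₂, v₁)`, arbitrary coins.** -/
theorem darc_of_towerMarkerV₁_coins_swap (pr : E → R) (hp : IsProbVec pr) (hS : SameEnds arcs)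
    (h₁ : OrTailK arcs s U ent₁ c₁ v₁) (hT : OrTower arcs s (insert v₁ U) rest)
    (h : OrTailK arcs s (towerCore (insert v₁ U) rest) ent c a)
    {m₂ : V} (hm₂ : m₂ ∈ U) (hcovL : ∀ x ∈ rest, ∀ r ∈ x.1, r = m₂ ∨ r ∉ U)
    (hcov : ∀ r ∈ ent, r = m₂ ∨ r ∉ U)
    (hν : ∀ W W', W ⊆ U → W' ⊆ U →
      prob pr (coreLevel arcs s U W) * prob pr (coreLevel arcs s U W') ≤
        prob pr (coreLevel arcs s U (W ∩ W')) * prob pr (coreLevel arcs s U (W ∪ W')))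
    {t : V} (htC : t ∉ insert a (towerCore (insert v₁ U) rest)) (hts : t ≠ s) (hws : w ≠ s)
    (hwC : w ∉ insert a (towerCore (insert v₁ U) rest)) :
    DARC pr arcs s {t} m₂ v₁ a w :=
  (darc_swap pr arcs s {t} v₁ m₂ a w).1
    (darc_of_towerMarkerV₁_coins pr hp hS h₁ hT h hm₂ hcovL hcov hν htC hts hws hwC)

/-- **COROLLARY (out-tree core, arbitrary coins).** -/
theorem darc_of_towerTreeMarkerV₁_coins (pr : E → R) (hp : IsProbVec pr) (hS : SameEnds arcs)
    (h₁ : OrTailK arcs s U ent₁ c₁ v₁) (hT : OrTower arcs s (insert v₁ U) rest)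
    (h : OrTailK arcs s (towerCore (insert v₁ U) rest) ent c a)
    {cT : V → E} {par : V → V} {rk : V → ℕ} (hTr : TreeCore arcs s U cT par rk)
    {m₂ : V} (hm₂ : m₂ ∈ U) (hcovL : ∀ x ∈ rest, ∀ r ∈ x.1, r = m₂ ∨ r ∉ U)
    (hcov : ∀ r ∈ ent, r = m₂ ∨ r ∉ U)
    {t : V} (htC : t ∉ insert a (towerCore (insert v₁ U) rest)) (hts : t ≠ s) (hws : w ≠ s)
    (hwC : w ∉ insert a (towerCore (insert v₁ U) rest)) :
    DARC pr arcs s {t} v₁ m₂ a w :=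
  darc_of_towerMarkerV₁_coins pr hp hS h₁ hT h hm₂ hcovL hcov (hTr.coreLevel_lsm pr hp) htC hts
    hws hwC

end TowerMarkerCoins

end Summit.Ventures.PercRepro2.Coin
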